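import Literature.NumberTheory.EllipticCurves.NonvanishingTwistsWaldspurgerOfHoffsteinLuo
import Literature.NumberTheory.EllipticCurves.QuadraticTwistKroneckerRootNumberProofs
import Literature.NumberTheory.EllipticCurves.MatsunoTwistedCurvesPrimesProofs
import Literature.NumberTheory.EllipticCurves.MatsunoCurvesPrimesProofs
import HarnessLib

/-!
# Non-vanishing `p`-unramified quadratic twists of EITHER sign at a prime `p ‖ N` (twist supply)

HONEST FRAMING (cell `b2b-bsdres`, run/shared/lean/b2b/bsd-rank1-residual/, verbatim in every
file): the goal of the cell is to DELETE the COMBINATION-SHAPED residual classes of the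
Birch–Swinnerton-Dyer formula for ALL analytic-rank `≤ 1` elliptic curves over `ℚ` — "full BSD
formula for every rank `≤ 1` curve in class `C`" assembled STRICTLY from published theorems — so
that the rank-`≤ 1` remainder becomes exactly the CONSTRUCTION-SHAPED classes, which are TYPED
(missing-input `Prop`s), NOT attempted. This is not "finishing BSD". Sub-cell
`b2b-bsdres-additive-p1` (CLASS-OWNERS row "X3/X4 additive — pot. multiplicative / X3♯(M)"),
generation 3; research route, no claim beyond the stated sub-classes; X3♯(M), X4(M) REMAIN
CONSTRUCTION-SHAPED.

Theorems only; no definition, no new named fact. The base-change-and-descend route of this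
sub-cell (`Descent.lean` … `ModelFreeClassTheorems.lean`) converts an X3♯(M) / X4(M) pair `(E, p)`
to ONE typed statement over a quadratic field as soon as a `p`-MULTIPLICATIVE quadratic twist
`E^{(D)}` with `L(E^{(D)}, 1) ≠ 0` (and gvpar, resp. (ram)) is available; generations 0–2 exhibited
such twists pair by pair (census). This file makes the ANALYTIC half of that datum a theorem, for
every curve, from published facts already in the tree:

* **`exists_twist_L_ne_zero_of_sign`** — let `W/ℚ` be elliptic and `p` an odd prime with
  `p ‖ N_W` (`p ∣ N_W`, `p² ∤ N_W`: a multiplicative prime). For EITHER prescribed sign `s = ±1`,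
  every finite set `S` of primes and every bound `B` there is a square-free `n ≡ 1 (mod 8)` with
  `|n| > B`, `sign n = s`, `p ∤ n`, `(n/ℓ) = 1` for every odd prime `ℓ ∈ S` other than `p`, and
  `L(W^{(n)}, 1) ≠ 0`.

Inputs (named facts already consumed elsewhere in the tree, carried as hypotheses): the Modularity
Theorem `exists_isNewformOf` (BCDT 2001) and Hoffstein–Luo 1997, Theorem
(`HoffsteinLuo1997_exists_twist_L_one_ne_zero`: square-free `d ≡ 1 (mod 8)` with `(d/ℓ) = 1` on any
finite set of odd primes and `L(W^{(d)}, 1) ≠ 0` — no sign hypothesis, sign of `d` unspecified).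
Proof. By the tree's PROVED twist root number `w(W^{(d)}) = (−1/|d|)(N_W/|d|) w(W)` (Murty–Murty
1997 Ch. 6 §1, `rootNumber_quadraticTwist_of_emod_four_eq_one`) and `L ≠ 0 ⇒ w = +1`
(`rootNumber_eq_one_of_entireLFunction_one_ne_zero`, unconditional), a Hoffstein–Luo `d` split at
every prime of `N_W` has `sign d = w(W)` (`jacobiSym_neg_one_natAbs_eq_rootNumber`). For the other
sign, twist first by an auxiliary prime `u ≡ 1 (mod 8)` with `(ℓ/u) = 1` at the odd primes
`ℓ ≠ p` of `N_W` and of `S` and `(p/u) = −1` (Dirichlet + CRT + reciprocity,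
`exists_prime_one_mod_eight_jacobiSym_eq`): then `w(W^{(u)}) = (N_W/u) w(W) = −w(W)` because
`p ‖ N_W`, and a Hoffstein–Luo `d` for `W^{(u)}` gives `n = u d` with `W^{(ud)} = (W^{(u)})^{(d)}`
(`quadraticTwist_quadraticTwist`). Either way `(n/p) ≠ 0`, so `p ∤ n` and every model of `W^{(n)}`
is again multiplicative at `p` (consumers: `TwistSupply.lean`).

## References (all inputs are tree theorems / tree named facts)

* [HoffsteinLuo1997] J. Hoffstein, W. Luo, Math. Res. Lett. 4 (1997), Theorem (pp. 435–436).
* [MurtyMurty1997] M. R. Murty, V. K. Murty, *Non-vanishing of L-functions and applications*,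
  Ch. 6 §1 (sign of the twisted functional equation).
* [BCDTJAMS2001] C. Breuil, B. Conrad, F. Diamond, R. Taylor, JAMS 14 (2001), Thm. A.
* [FriedbergHoffstein1995] S. Friedberg, J. Hoffstein, Ann. of Math. 142 (1995), Thm. B (the
  general prescribed-local-components statement of which this is the elliptic-curve shadow; NOT
  used as an input here).
-/

noncomputable section

open scoped Classical NumberTheorySymbols

open WeierstrassCurve Literature.NumberTheory.EllipticCurves
  Literature.NumberTheory.EllipticCurves.ModularForms Literature.NumberTheory.QuadraticFields

namespace Summit.BirchSwinnertonDyer.Rank1Residual.AdditivePotMult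

/-! ### §1 Jacobi-symbol bookkeeping -/

/-- For `d ≡ 1 (mod 4)`: `sign d = (−1/|d|)` (`= χ₄(|d|)`; `|d| ≡ 1 (mod 4)` iff `d > 0`).
[folklore] -/
theorem sign_eq_jacobiSym_neg_one_natAbs {d : ℤ} (hd4 : d % 4 = 1) :
    d.sign = J(-1 | d.natAbs) := by
  have hd0 : d ≠ 0 := by rintro rfl; norm_num at hd4
  have hodd : Odd d.natAbs := Int.natAbs_odd.mpr (Int.odd_iff.mpr (by omega))
  rw [jacobiSym.at_neg_one hodd]
  rcases lt_or_gt_of_ne hd0 with hneg | hpos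
  · have habs : (d.natAbs : ℤ) = -d := Int.ofNat_natAbs_of_nonpos hneg.le
    have h3 : d.natAbs % 4 = 3 := by omega
    rw [ZMod.χ₄_nat_three_mod_four h3, Int.sign_eq_neg_one_of_neg hneg]
  · have habs : (d.natAbs : ℤ) = d := Int.natAbs_of_nonneg hpos.le
    have h1 : d.natAbs % 4 = 1 := by omega
    rw [ZMod.χ₄_nat_one_mod_four h1, Int.sign_eq_one_of_pos hpos]

/-- `(M/u) = 1` as soon as `(ℓ/u) = 1` for every prime factor `ℓ` of `M ≠ 0` (complete
multiplicativity of the Jacobi symbol in the numerator). [folklore] -/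
theorem jacobiSym_natCast_eq_one_of_primeFactors {u : ℕ} :
    ∀ {M : ℕ}, M ≠ 0 → (∀ ℓ ∈ M.primeFactors, J((ℓ : ℤ) | u) = 1) → J((M : ℤ) | u) = 1 := by
  intro M
  induction M using Nat.recOnMul with
  | zero => intro h; exact absurd rfl h
  | one => intro _ _; rw [Nat.cast_one, jacobiSym.one_left]
  | prime ℓ hℓ => intro _ h; exact h ℓ (Nat.mem_primeFactors.mpr ⟨hℓ, dvd_rfl, hℓ.ne_zero⟩)
  | mul a b iha ihb =>
    intro hab h
    have ha : a ≠ 0 := fun h0 ↦ hab (by rw [h0, zero_mul])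
    have hb : b ≠ 0 := fun h0 ↦ hab (by rw [h0, mul_zero])
    rw [Nat.cast_mul, jacobiSym.mul_left,
      iha ha (fun ℓ hℓ ↦ h ℓ (Nat.primeFactors_mono (dvd_mul_right a b) hab hℓ)),
      ihb hb (fun ℓ hℓ ↦ h ℓ (Nat.primeFactors_mono (dvd_mul_left b a) hab hℓ)), one_mul]

/-- `(d/ℓ) = 1` at a prime `ℓ` forces `ℓ ∤ d`. [folklore] -/
theorem not_dvd_of_jacobiSym_eq_one {d : ℤ} {ℓ : ℕ} (hℓ : ℓ.Prime) (h : jacobiSym d ℓ = 1) :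
    ¬ (ℓ : ℤ) ∣ d := fun hdvd ↦ by
  have h0 : jacobiSym d ℓ = 0 := by
    rw [jacobiSym.mod_left, Int.emod_eq_zero_of_dvd hdvd, jacobiSym.zero_left hℓ.one_lt]
  rw [h0] at h
  exact zero_ne_one h

/-- **An auxiliary prime with prescribed quadratic characters.** For a finite set `T` of odd primes,
signs `ε_ℓ = ±1` (`ℓ ∈ T`) and a bound `B` there is a prime `u > B`, `u ≡ 1 (mod 8)`, with
`(ℓ/u) = ε_ℓ` for all `ℓ ∈ T` (Dirichlet's theorem for the modulus `8 ∏ ℓ`, the Chinese remainder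
theorem, and quadratic reciprocity for `u ≡ 1 (mod 4)`: `(ℓ/u) = (u/ℓ)`; tree
`QuadraticFieldAux.exists_prime_gt_modEq_family`, `exists_jacobiSym_eq_sign`). [folklore] -/
theorem exists_prime_one_mod_eight_jacobiSym_eq (T : Finset ℕ) (hT : ∀ ℓ ∈ T, ℓ.Prime ∧ ℓ ≠ 2)
    (ε : ℕ → ℤ) (hε : ∀ ℓ ∈ T, ε ℓ = 1 ∨ ε ℓ = -1) (B : ℕ) :
    ∃ u : ℕ, B < u ∧ u.Prime ∧ u % 8 = 1 ∧ ∀ ℓ ∈ T, J((ℓ : ℤ) | u) = ε ℓ := by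
  have hres : ∀ ℓ ∈ T, ∃ a : ℕ, ¬ ℓ ∣ a ∧ jacobiSym a ℓ = ε ℓ :=
    fun ℓ hℓ ↦ exists_jacobiSym_eq_sign (hT ℓ hℓ).1 (hT ℓ hℓ).2 (hε ℓ hℓ)
  choose! a ha hJa using hres
  set e := T.equivFin with he
  set ℓf : Fin T.card → ℕ := fun i ↦ ((e.symm i : T) : ℕ) with hℓf
  have hmem : ∀ i, ℓf i ∈ T := fun i ↦ (e.symm i).2
  have hℓP : ∀ i, (ℓf i).Prime := fun i ↦ (hT _ (hmem i)).1
  have hinj : Function.Injective ℓf := fun i j h ↦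
    e.symm.injective (Subtype.ext h)
  have hℓA : ∀ i, ¬ ℓf i ∣ 8 := fun i h ↦ by
    have hP := hℓP i
    have h2 : ℓf i ∣ 2 ^ 3 := by norm_num; exact h
    exact (hT _ (hmem i)).2 ((Nat.prime_dvd_prime_iff_eq hP Nat.prime_two).mp (hP.dvd_of_dvd_pow h2))
  set r : Fin T.card → ℕ := fun i ↦ a (ℓf i) with hr
  have hrc : ∀ i, Nat.Coprime (r i) (ℓf i) := fun i ↦
    ((Nat.Prime.coprime_iff_not_dvd (hℓP i)).mpr (ha _ (hmem i))).symm
  obtain ⟨u, hBu, hu, hu8, hur⟩ :=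
    QuadraticFieldAux.exists_prime_gt_modEq_family ℓf hℓP hinj (A := 8) (by norm_num) hℓA r hrc 1
      (by norm_num) B
  have hu8' : u % 8 = 1 := by
    have h := hu8; unfold Nat.ModEq at h; omega
  refine ⟨u, hBu, hu, hu8', fun ℓ hℓ ↦ ?_⟩
  have hu4 : u % 4 = 1 := by omega
  have hℓodd : Odd ℓ := (hT ℓ hℓ).1.odd_of_ne_two (hT ℓ hℓ).2
  rw [← jacobiSym.quadratic_reciprocity_one_mod_four hu4 hℓodd]
  have hi := hur (e ⟨ℓ, hℓ⟩)
  have hℓi : ℓf (e ⟨ℓ, hℓ⟩) = ℓ := by simp [hℓf]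
  rw [hℓi] at hi
  have hri : r (e ⟨ℓ, hℓ⟩) = a ℓ := by simp [hr, hℓf]
  rw [hri] at hi
  -- `hi : u ≡ a ℓ [MOD ℓ]`
  have hiZ : (u : ℤ) % (ℓ : ℤ) = ((a ℓ : ℕ) : ℤ) % (ℓ : ℤ) := by exact_mod_cast hi
  rw [jacobiSym.mod_left (u : ℤ) ℓ, hiZ, ← jacobiSym.mod_left]
  exact hJa ℓ hℓ

/-! ### §2 The sign of a non-vanishing twist split at the conductor -/

/-- **The sign of a non-vanishing twist split at the conductor is the root number.** Let `W/ℚ` be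
elliptic and `d` square-free, `d ≡ 1 (mod 4)`, with `(d/ℓ) = 1` for every odd prime `ℓ ∣ N_W` and
`d ≡ 1 (mod 8)` if `2 ∣ N_W`. If `L(W^{(d)}, 1) ≠ 0` then `(−1/|d|) = w(W)`, i.e. `sign d = w(W)`:
by the twist root number `w(W^{(d)}) = (−1/|d|)(N_W/|d|) w(W)` from Modularity (Murty–Murty 1997,
Ch. 6 §1; tree `rootNumber_quadraticTwist_of_emod_four_eq_one`), `(N_W/|d|) = 1` under the
splitting conditions (`jacobiChar_natAbs_natCast_eq_one_of_forall_prime`), and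
`w(W^{(d)}) = +1` since `L(W^{(d)},1) ≠ 0` (`rootNumber_eq_one_of_entireLFunction_one_ne_zero`).
[cite: MurtyMurty1997, Ch. 6 §1, p. 96] -/
theorem jacobiSym_neg_one_natAbs_eq_rootNumber (hmod : exists_isNewformOf) (W : WeierstrassCurve ℚ)
    [W.IsElliptic] {d : ℤ} (hsq : Squarefree d) (hd4 : d % 4 = 1)
    (h2 : 2 ∣ W.conductorNorm ℤ → d % 8 = 1)
    (hjac : ∀ ℓ : ℕ, ℓ.Prime → ℓ ∣ W.conductorNorm ℤ → ℓ ≠ 2 → jacobiSym d ℓ = 1)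
    (hL : (W.quadraticTwist (d : ℚ)).entireLFunction 1 ≠ 0) :
    J(-1 | d.natAbs) = W.rootNumber := by
  set N : ℕ := W.conductorNorm ℤ with hN
  have hN0 : N ≠ 0 := (W.conductorNorm_pos_holds).ne'
  have hd2 : ¬ (2 : ℤ) ∣ d := by omega
  have hgcd : Int.gcd d N = 1 := int_gcd_eq_one_of_forall_jacobiSym_eq_one hd2 hjac
  have hd0 : (d : ℚ) ≠ 0 := by exact_mod_cast hsq.ne_zero
  haveI := W.isElliptic_quadraticTwist hd0
  haveI : NeZero d.natAbs := ⟨Int.natAbs_ne_zero.mpr hsq.ne_zero⟩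
  obtain ⟨hw, -⟩ := W.rootNumber_quadraticTwist_of_emod_four_eq_one hmod hd4 hsq hgcd
  have hJN : J((N : ℤ) | d.natAbs) = 1 := by
    have h := jacobiChar_natAbs_natCast_eq_one_of_forall_prime hd4 hN0
      (fun p hp hpN ↦ ⟨fun hp2 ↦ h2 (hp2 ▸ hpN), fun hp2 ↦ hjac p hp hpN hp2⟩)
    rw [jacobiChar_natCast] at h
    exact_mod_cast h
  have h1 : (W.quadraticTwist (d : ℚ)).rootNumber = 1 :=
    WeierstrassCurve.rootNumber_eq_one_of_entireLFunction_one_ne_zero hL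
  rw [h1, hJN, mul_one] at hw
  rcases W.rootNumber_eq_one_or with h | h <;> rw [h] at hw ⊢ <;> linarith

/-! ### §3 Twist supply: both signs -/

/-- **Non-vanishing `p`-unramified quadratic twists of either sign at a prime `p ‖ N`.** Let `W/ℚ`
be elliptic, `p` an odd prime with `p ∣ N_W`, `p² ∤ N_W` (a multiplicative prime), `S` a finite
set of naturals, `s = ±1` and `B` a bound. Assuming the Modularity Theorem (`hmod`) and
Hoffstein–Luo 1997 (`hHL`), there is a square-free integer `n ≡ 1 (mod 8)` with `|n| > B`,
`sign n = s`, `p ∤ n`, `(n/ℓ) = 1` for every odd prime `ℓ ∈ S` other than `p`, and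
`L(W^{(n)}, 1) ≠ 0`. Proof: if `s = w(W)`, Hoffstein–Luo's `d` for `W` (split at the primes of
`N_W` and of `S`) has `sign d = w(W)` (`jacobiSym_neg_one_natAbs_eq_rootNumber`); if `s = −w(W)`,
take an auxiliary prime `u ≡ 1 (mod 8)`, `u > N_W`, with `(ℓ/u) = 1` at the odd primes `ℓ ≠ p`
of `N_W` and `S` and `(p/u) = −1` (`exists_prime_one_mod_eight_jacobiSym_eq`): then
`w(W^{(u)}) = (−1/u)(N_W/u) w(W) = −w(W) = s` (`p ‖ N_W`), and Hoffstein–Luo's `d` for `W^{(u)}`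
gives `n = u d`, `W^{(ud)} = (W^{(u)})^{(d)}`. Theorem-level form of the twist censuses of
generations 0–2 (REPORT §5, §6.4–6.5). [cite: HoffsteinLuo1997, Theorem (§1, pp. 435–436)]
[cite: MurtyMurty1997, Ch. 6 §1, p. 96] -/
theorem exists_twist_L_ne_zero_of_sign (hmod : exists_isNewformOf)
    (hHL : HoffsteinLuo1997_exists_twist_L_one_ne_zero)
    (W : WeierstrassCurve ℚ) [W.IsElliptic] {p : ℕ} (hp : p.Prime) (hp2 : p ≠ 2)
    (hpN : p ∣ W.conductorNorm ℤ) (hpN2 : ¬ p ^ 2 ∣ W.conductorNorm ℤ)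
    (S : Finset ℕ) {s : ℤ} (hs : s = 1 ∨ s = -1) (B : ℕ) :
    ∃ n : ℤ, Squarefree n ∧ n % 8 = 1 ∧ B < n.natAbs ∧ n.sign = s ∧ ¬ (p : ℤ) ∣ n ∧
      (∀ ℓ ∈ S, ℓ.Prime → ℓ ≠ 2 → ℓ ≠ p → jacobiSym n ℓ = 1) ∧
      (W.quadraticTwist (n : ℚ)).entireLFunction 1 ≠ 0 := by
  set N : ℕ := W.conductorNorm ℤ with hN
  have hN0 : N ≠ 0 := (W.conductorNorm_pos_holds).ne'
  by_cases hsw : s = W.rootNumber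
  · -- direct case: Hoffstein–Luo on `W`
    obtain ⟨d, hBd, hsq, hd8, -, hjac, hL⟩ := hHL W (S ∪ N.primeFactors) B
    have hjacN : ∀ ℓ : ℕ, ℓ.Prime → ℓ ∣ N → ℓ ≠ 2 → jacobiSym d ℓ = 1 := fun ℓ hℓ hℓN hℓ2 ↦
      hjac ℓ (Finset.mem_union_right _ (Nat.mem_primeFactors.mpr ⟨hℓ, hℓN, hN0⟩)) hℓ hℓ2
    have hsign : d.sign = s := by
      rw [sign_eq_jacobiSym_neg_one_natAbs (by omega), hsw]
      exact jacobiSym_neg_one_natAbs_eq_rootNumber hmod W hsq (by omega) (fun _ ↦ hd8) hjacN hL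
    refine ⟨d, hsq, hd8, hBd, hsign, not_dvd_of_jacobiSym_eq_one hp (hjacN p hp hpN hp2), ?_, hL⟩
    exact fun ℓ hℓ hℓp hℓ2 _ ↦ hjac ℓ (Finset.mem_union_left _ hℓ) hℓp hℓ2
  · -- opposite case: auxiliary prime `u`
    have hw : W.rootNumber = -s := by
      rcases hs with rfl | rfl <;> rcases W.rootNumber_eq_one_or with h | h <;> simp_all
    set T : Finset ℕ := (S ∪ N.primeFactors).filter (fun ℓ ↦ ℓ.Prime ∧ ℓ ≠ 2) with hT_def
    have hT : ∀ ℓ ∈ T, ℓ.Prime ∧ ℓ ≠ 2 := fun ℓ hℓ ↦ (Finset.mem_filter.mp hℓ).2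
    set ε : ℕ → ℤ := fun ℓ ↦ if ℓ = p then -1 else 1 with hε_def
    have hε : ∀ ℓ ∈ T, ε ℓ = 1 ∨ ε ℓ = -1 := fun ℓ _ ↦ by
      by_cases h : ℓ = p <;> simp [hε_def, h]
    obtain ⟨u, hBu, hu, hu8, hJu⟩ :=
      exists_prime_one_mod_eight_jacobiSym_eq T hT ε hε (B + N + S.sup id)
    have huN : N < u := by omega
    have hu2 : u ≠ 2 := by omega
    have hu4 : u % 4 = 1 := by omega
    have huodd : Odd u := Nat.odd_iff.mpr (by omega)
    have hudvd : ¬ u ∣ N := fun h ↦ absurd huN (not_lt.mpr (Nat.le_of_dvd (Nat.pos_of_ne_zero hN0) h))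
    have hup : u ≠ p := fun h ↦ hudvd (h ▸ hpN)
    have huS : u ∉ S := fun h ↦ by
      have : u ≤ S.sup id := Finset.le_sup (f := id) h
      omega
    have hpT : p ∈ T := Finset.mem_filter.mpr
      ⟨Finset.mem_union_right _ (Nat.mem_primeFactors.mpr ⟨hp, hpN, hN0⟩), hp, hp2⟩
    have hJpu : J((p : ℤ) | u) = -1 := by rw [hJu p hpT]; simp [hε_def]
    -- `u` as an integer twisting parameter
    have hu4Z : (u : ℤ) % 4 = 1 := by exact_mod_cast hu4
    have husqZ : Squarefree (u : ℤ) := Int.squarefree_natCast.mpr hu.prime.squarefree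
    have hgcd : Int.gcd (u : ℤ) N = 1 := by
      rw [Int.gcd_natCast_natCast]
      exact (Nat.Prime.coprime_iff_not_dvd hu).mpr hudvd
    have hu0 : ((u : ℤ) : ℚ) ≠ 0 := by exact_mod_cast hu.ne_zero
    haveI : (W.quadraticTwist ((u : ℤ) : ℚ)).IsElliptic := W.isElliptic_quadraticTwist hu0
    obtain ⟨hw₁, -⟩ := W.rootNumber_quadraticTwist_of_emod_four_eq_one hmod hu4Z husqZ hgcd
    rw [Int.natAbs_natCast] at hw₁
    have hJ1 : J(-1 | u) = 1 := by rw [jacobiSym.at_neg_one huodd, ZMod.χ₄_nat_one_mod_four hu4]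
    have hJN : J((N : ℤ) | u) = -1 := by
      obtain ⟨M, hM⟩ := hpN
      have hpM : ¬ p ∣ M := fun h ↦ hpN2 (by rw [hM, pow_two]; exact Nat.mul_dvd_mul_left p h)
      have hM0 : M ≠ 0 := fun h ↦ hN0 (by rw [hM, h, mul_zero])
      have hJM : J((M : ℤ) | u) = 1 := by
        refine jacobiSym_natCast_eq_one_of_primeFactors hM0 fun ℓ hℓ ↦ ?_
        obtain ⟨hℓp, hℓM, -⟩ := Nat.mem_primeFactors.mp hℓ
        by_cases hℓ2 : ℓ = 2
        · subst hℓ2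
          rw [Nat.cast_ofNat, jacobiSym.at_two huodd, ZMod.χ₈_nat_eq_if_mod_eight]
          have h8 : u % 8 = 1 := hu8
          have h2' : u % 2 = 1 := by omega
          simp [h8, h2']
        · have hℓN : ℓ ∣ N := hM ▸ hℓM.mul_left p
          have hℓT : ℓ ∈ T := Finset.mem_filter.mpr
            ⟨Finset.mem_union_right _ (Nat.mem_primeFactors.mpr ⟨hℓp, hℓN, hN0⟩), hℓp, hℓ2⟩
          have hℓnp : ℓ ≠ p := fun h ↦ hpM (h ▸ hℓM)
          rw [hJu ℓ hℓT]
          simp [hε_def, hℓnp]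
      rw [hM, Nat.cast_mul, jacobiSym.mul_left, hJpu, hJM]
      norm_num
    have hw₁' : (W.quadraticTwist ((u : ℤ) : ℚ)).rootNumber = s := by
      rw [hw₁, hJ1, hJN, hw]; ring
    -- Hoffstein–Luo on `W^{(u)}`
    set N₁ : ℕ := (W.quadraticTwist ((u : ℤ) : ℚ)).conductorNorm ℤ with hN₁_def
    have hN₁0 : N₁ ≠ 0 := ((W.quadraticTwist ((u : ℤ) : ℚ)).conductorNorm_pos_holds).ne'
    obtain ⟨d, hBd, hsq, hd8, -, hjac, hL⟩ :=
      hHL (W.quadraticTwist ((u : ℤ) : ℚ)) (S ∪ N₁.primeFactors ∪ {p, u}) B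
    have hjacN₁ : ∀ ℓ : ℕ, ℓ.Prime → ℓ ∣ N₁ → ℓ ≠ 2 → jacobiSym d ℓ = 1 := fun ℓ hℓ hℓN hℓ2 ↦
      hjac ℓ (by simp [Finset.mem_union, Nat.mem_primeFactors, hℓ, hℓN, hN₁0]) hℓ hℓ2
    have hsignd : d.sign = s := by
      rw [sign_eq_jacobiSym_neg_one_natAbs (by omega), ← hw₁']
      exact jacobiSym_neg_one_natAbs_eq_rootNumber hmod _ hsq (by omega) (fun _ ↦ hd8) hjacN₁ hL
    have hdp : jacobiSym d p = 1 := hjac p (by simp) hp hp2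
    have hdu : jacobiSym d u = 1 := hjac u (by simp) hu hu2
    have hpd : ¬ (p : ℤ) ∣ d := not_dvd_of_jacobiSym_eq_one hp hdp
    have hud : ¬ (u : ℤ) ∣ d := not_dvd_of_jacobiSym_eq_one hu hdu
    have hpZ : Prime (p : ℤ) := Nat.prime_iff_prime_int.mp hp
    refine ⟨u * d, ?_, ?_, ?_, ?_, ?_, ?_, ?_⟩
    · -- square-free
      rw [← Int.squarefree_natAbs, Int.natAbs_mul, Int.natAbs_natCast]
      refine (Nat.squarefree_mul ?_).mpr ⟨hu.prime.squarefree, Int.squarefree_natAbs.mpr hsq⟩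
      exact (Nat.Prime.coprime_iff_not_dvd hu).mpr (fun h ↦ hud (Int.natCast_dvd.mpr h))
    · -- `≡ 1 (mod 8)`
      have h8 : (u : ℤ) % 8 = 1 := by exact_mod_cast hu8
      rw [Int.mul_emod, h8, hd8]; norm_num
    · -- size
      rw [Int.natAbs_mul, Int.natAbs_natCast]
      exact lt_of_lt_of_le hBd (Nat.le_mul_of_pos_left _ hu.pos)
    · -- sign
      rw [Int.sign_mul, Int.sign_eq_one_of_pos (by exact_mod_cast hu.pos), one_mul, hsignd]
    · -- `p ∤ u d`
      intro h
      rcases hpZ.dvd_or_dvd h with hpu | hpd'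
      · exact hup ((Nat.prime_dvd_prime_iff_eq hp hu).mp (Int.natCast_dvd_natCast.mp hpu)).symm
      · exact hpd hpd'
    · -- symbols at the odd primes of `S` other than `p`
      intro ℓ hℓ hℓp hℓ2 hℓnp
      have hℓT : ℓ ∈ T := Finset.mem_filter.mpr ⟨Finset.mem_union_left _ hℓ, hℓp, hℓ2⟩
      have hℓu : J((u : ℤ) | ℓ) = 1 := by
        rw [jacobiSym.quadratic_reciprocity_one_mod_four hu4 (hℓp.odd_of_ne_two hℓ2), hJu ℓ hℓT]
        simp [hε_def, hℓnp]
      rw [jacobiSym.mul_left, hℓu, hjac ℓ (by simp [hℓ]) hℓp hℓ2, one_mul]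
    · -- the `L`-value: `W^{(ud)} = (W^{(u)})^{(d)}`
      rwa [Int.cast_mul, ← quadraticTwist_quadraticTwist]

end Summit.BirchSwinnertonDyer.Rank1Residual.AdditivePotMult

end
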